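import Summits.CriticalPhenomena.PercolationContinuityZ3.Theorems.FK.RandomClusterBoundaryConditionCost
import Summits.CriticalPhenomena.PercolationContinuityZ3.Theorems.FK.RandomClusterEdgeDensityGibbs
import Summits.CriticalPhenomena.PercolationContinuityZ3.Theorems.FK.MagnetizationPlateauLowerBound
import HarnessLib

/-!
# LARGE DEVIATIONS OF THE NUMBER OF OPEN EDGES OF THE RANDOM-CLUSTER MODEL, V: PHASE COEXISTENCE OF THE EDGE DENSITY — BOTH
# ENDPOINTS `d·h⁰(p,q)` AND `d·h¹(p,q)` ARE REACHED AT SUB-VOLUME-ORDER COST UNDER FREE AND WIRED BOUNDARY CONDITIONS AND UNDER EVERY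
# INFINITE-VOLUME RANDOM-CLUSTER MEASURE (Grimmett 2006 Thm. (4.58), (4.71), Lemma (4.14)(b), Thm. (4.19)(c); Ellis 2006 Thm. V.6.1)

Claimed R42 (8)(c) in the cell INBOX at 2026-08-29T13:10:41Z by fkp-10a gen 360 (NEW CLAIM #5 of the gen), addressed to coordinator fk-4 gen 299 (seated 12:03Z 2026-08-29; R182–R185 in force; ruling R186 requested); lineage row FO-10a-g360x (self-suggested), package g360-rccoex, label RC-E.
Helper file of the `fk-continuity` build cell (bschramm lane; `--supports stmt-CriticalPhenomena-4575`; fkp-10a gen 360,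
package g360-rccoex, label RC-E); builds on p205010 (kernel theorem, internal audit signed; external expert review
pending). No definitions, no named facts, no sorries; standard axioms.
UNCONDITIONAL (`q ≥ 1`, `0 < p < 1`, `d ≥ 1` through a lattice edge `e₀`; random-cluster box measures `φ^b_{Λ_N,p,q}`, `b ∈ {free, wired}`;
every `FKGibbs d p q P`; `|ω|` / `|ω ∩ E_N|` = number of open edges of `Λ_N`, `E_N = edgesIn (zdGraph d) Λ_N`, `h⁰ = freeEdgeDensity`,
`h¹ = wiredEdgeDensity`).
Scope: volume-order LOWER bounds `e^{−ε|Λ_N|}` for the windows of the edge density at the two endpoint densities `d·h⁰(p,q)` and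
`d·h¹(p,q)` only (no statement strictly between them, no surface-order rate, nothing at or about `p_c(q)`, nothing on FH / TP_FK); nothing
percolation-bearing.

The random-cluster analogue of the Ising file `MagnetizationPhaseCoexistence`: by file IV the wired boundary condition costs at most
`q^{|∂Λ_N|}` on every event and the endpoint events are massive under their own boundary condition; by files II–III the far tails beyond
`d·h¹ + δ` / below `d·h⁰ − δ` are exponentially small under both boundary conditions and every `FKGibbs` measure:

* **`eventually_forall_b_exp_le_edge_window_high`** / **`_low`** — ∀ `δ, ε > 0`, eventually in `N`, for BOTH `b`:
  `e^{−ε|Λ_N|} ≤ φ^b_{Λ_N,p,q}{||ω| − d·h¹|Λ_N|| < δ|Λ_N|}` and `e^{−ε|Λ_N|} ≤ φ^b_{Λ_N,p,q}{||ω| − d·h⁰|Λ_N|| < δ|Λ_N|}` — at a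
  first-order point (`h⁰ < h¹`) the FREE box measure reaches the WIRED density and vice versa at sub-volume-order cost;
* `regionFreeReal_edgeCount_ge`, `regionWiredReal_edgeCount_le`, `fkGibbs_regionWiredReal_le_of_isLowerSet` — sandwich bookkeeping
  (`P(A) ≥ φ⁰_{Λ_N}(A)` for increasing, `P(D) ≥ φ¹_{Λ_N}(D)` for decreasing events of `E_N`);
* **`fkGibbs_exp_le_edge_window_high`** / **`_low`** — the same two windows under EVERY infinite-volume random-cluster measure
  `FKGibbs d p q P` (with `rcLimit_upper/lower_tail_exp_decay` of file III: both `φ^b_{p,q}` charge both endpoint densities).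

## References

* G. Grimmett, *The Random-Cluster Model*, Springer (2006), §4.5 Thm. (4.58) with (4.71), Lemma (4.14)(b), Thm. (4.19)(c) (4.21),
  Thm. (4.63), (4.77). [Grimmett2006]
* R. S. Ellis, *Entropy, Large Deviations, and Statistical Mechanics*, Springer (2006), Thm. II.6.1, Thm. V.6.1 (d)–(e). [Ellis2006]
-/

noncomputable section

namespace Summit.CriticalPhenomena.PercolationContinuityZ3.Theorems.FK

namespace RandomClusterLargeDeviations

open Finset Filter Topology Set MeasureTheory
open Literature.Probability.LatticeModels Literature.Probability.Percolation

variable {d : ℕ} {p q : ℝ} {e₀ : Sym2 (Site d)}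

/-! ### Both endpoint windows under both boundary conditions -/

/-- **THE WIRED-DENSITY WINDOW UNDER BOTH BOUNDARY CONDITIONS**: for `δ, ε > 0`, eventually in `N`, for BOTH `b`,
`e^{−ε|Λ_N|} ≤ φ^b_{Λ_N,p,q}{||ω| − d·h¹(p,q)|Λ_N|| < δ|Λ_N|}` — in particular the FREE measure reaches the wired edge density at
sub-volume-order cost. [cite: Grimmett2006, Thm. (4.58) with (4.71), Thm. (4.63); Ellis2006, Thm. V.6.1 (d)–(e)] -/
theorem eventually_forall_b_exp_le_edge_window_high (hp : p ∈ Set.Ioo (0 : ℝ) 1) (hq : 1 ≤ q) (he₀ : e₀ ∈ (zdGraph d).edgeSet)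
    {δ : ℝ} (hδ : 0 < δ) {ε : ℝ} (hε : 0 < ε) :
    ∀ᶠ N : ℕ in atTop, ∀ b : Bool,
      Real.exp (-(ε * #(box d N))) ≤ (rcMeasure (finsetGraph (zdGraph d) (box d N)) p q (boxBC d b N)).real
        {η : BondConfig ↥(box d N) | |(η.ncard : ℝ) - d * wiredEdgeDensity d p q e₀ * #(box d N)| < δ * #(box d N)} := by
  have hpI : p ∈ Set.Icc (0 : ℝ) 1 := ⟨hp.1.le, hp.2.le⟩
  have hq0 : 0 < q := one_pos.trans_le hq
  obtain ⟨i₀, -, -⟩ := exists_eq_map_add_of_mem_edgeSet he₀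
  have hd : 0 < d := i₀.pos
  obtain ⟨κ, hκ, hA⟩ := exists_pos_eventually_le_wired_high hpI hq he₀ (half_pos hδ)
  obtain ⟨c, hc, hU⟩ := rc_upper_tail_exp_decay hp hq he₀ (m := d * wiredEdgeDensity d p q e₀ + δ) (by linarith)
  refine eventually_forall_exp_le_of_boundary_sub_exp (d := d) hq hκ hc ?_ hd hε
  filter_upwards [hA, hU true, hU false] with N hAN hUt hUf b
  haveI := isProbabilityMeasure_rcMeasure (finsetGraph (zdGraph d) (box d N)) hpI hq0 (boxBC d b N)
  have hsub := IsingLargeDeviations.diff_halfLines_subset_window (fun η : BondConfig ↥(box d N) => (η.ncard : ℝ))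
    (#(box d N) : ℝ) δ (d * wiredEdgeDensity d p q e₀)
  have hUb : (rcMeasure (finsetGraph (zdGraph d) (box d N)) p q (boxBC d b N)).real
      {η : BondConfig ↥(box d N) | (d * wiredEdgeDensity d p q e₀ + δ) * #(box d N) ≤ (η.ncard : ℝ)} ≤
        Real.exp (-(c * #(box d N))) := by cases b; exacts [hUf, hUt]
  have hAb := (pow_inv_mul_rcMeasure_box_real_le hpI hq N true b
    {η : BondConfig ↥(box d N) | (d * wiredEdgeDensity d p q e₀ - δ / 2) * #(box d N) ≤ (η.ncard : ℝ)})
  have hAκ : (q ^ #(innerBoundary (zdGraph d) (box d N)))⁻¹ * κ ≤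
      (rcMeasure (finsetGraph (zdGraph d) (box d N)) p q (boxBC d b N)).real
        {η : BondConfig ↥(box d N) | (d * wiredEdgeDensity d p q e₀ - δ / 2) * #(box d N) ≤ (η.ncard : ℝ)} :=
    (mul_le_mul_of_nonneg_left hAN (inv_nonneg.2 (pow_nonneg hq0.le _))).trans hAb
  exact (sub_le_sub hAκ hUb).trans (IsingLargeDeviations.measureReal_sub_le_of_diff_subset _ hsub)

/-- **THE FREE-DENSITY WINDOW UNDER BOTH BOUNDARY CONDITIONS**: eventually in `N`, for both `b`,
`e^{−ε|Λ_N|} ≤ φ^b_{Λ_N,p,q}{||ω| − d·h⁰(p,q)|Λ_N|| < δ|Λ_N|}` — the WIRED measure reaches the free edge density at sub-volume-order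
cost. [cite: Grimmett2006, Thm. (4.58) with (4.71), Thm. (4.63); Ellis2006, Thm. V.6.1 (d)–(e)] -/
theorem eventually_forall_b_exp_le_edge_window_low (hp : p ∈ Set.Ioo (0 : ℝ) 1) (hq : 1 ≤ q) (he₀ : e₀ ∈ (zdGraph d).edgeSet)
    {δ : ℝ} (hδ : 0 < δ) {ε : ℝ} (hε : 0 < ε) :
    ∀ᶠ N : ℕ in atTop, ∀ b : Bool,
      Real.exp (-(ε * #(box d N))) ≤ (rcMeasure (finsetGraph (zdGraph d) (box d N)) p q (boxBC d b N)).real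
        {η : BondConfig ↥(box d N) | |(η.ncard : ℝ) - d * freeEdgeDensity d p q e₀ * #(box d N)| < δ * #(box d N)} := by
  have hpI : p ∈ Set.Icc (0 : ℝ) 1 := ⟨hp.1.le, hp.2.le⟩
  have hq0 : 0 < q := one_pos.trans_le hq
  obtain ⟨i₀, -, -⟩ := exists_eq_map_add_of_mem_edgeSet he₀
  have hd : 0 < d := i₀.pos
  obtain ⟨κ, hκ, hA⟩ := exists_pos_eventually_le_free_low hpI hq he₀ (half_pos hδ)
  obtain ⟨c, hc, hL⟩ := rc_lower_tail_exp_decay hp hq he₀ (m := d * freeEdgeDensity d p q e₀ - δ) (by linarith)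
  refine eventually_forall_exp_le_of_boundary_sub_exp (d := d) hq hκ hc ?_ hd hε
  filter_upwards [hA, hL true, hL false] with N hAN hLt hLf b
  haveI := isProbabilityMeasure_rcMeasure (finsetGraph (zdGraph d) (box d N)) hpI hq0 (boxBC d b N)
  have hsub := IsingLargeDeviations.diff_halfLines_subset_window_neg (fun η : BondConfig ↥(box d N) => (η.ncard : ℝ))
    (#(box d N) : ℝ) δ (d * freeEdgeDensity d p q e₀)
  have hLb : (rcMeasure (finsetGraph (zdGraph d) (box d N)) p q (boxBC d b N)).real
      {η : BondConfig ↥(box d N) | (η.ncard : ℝ) ≤ (d * freeEdgeDensity d p q e₀ - δ) * #(box d N)} ≤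
        Real.exp (-(c * #(box d N))) := by cases b; exacts [hLf, hLt]
  have hAb := (pow_inv_mul_rcMeasure_box_real_le hpI hq N false b
    {η : BondConfig ↥(box d N) | (η.ncard : ℝ) ≤ (d * freeEdgeDensity d p q e₀ + δ / 2) * #(box d N)})
  have hAκ : (q ^ #(innerBoundary (zdGraph d) (box d N)))⁻¹ * κ ≤
      (rcMeasure (finsetGraph (zdGraph d) (box d N)) p q (boxBC d b N)).real
        {η : BondConfig ↥(box d N) | (η.ncard : ℝ) ≤ (d * freeEdgeDensity d p q e₀ + δ / 2) * #(box d N)} :=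
    (mul_le_mul_of_nonneg_left hAN (inv_nonneg.2 (pow_nonneg hq0.le _))).trans hAb
  exact (sub_le_sub hAκ hLb).trans (IsingLargeDeviations.measureReal_sub_le_of_diff_subset _ hsub)

/-! ### Every infinite-volume random-cluster measure -/

/-- `φ⁰_{Λ_N,p,q}`-law of `{m ≤ |ω ∩ E_N|}` = the free box-measure tail. [cite: Grimmett2006, §4.2 (4.11)–(4.12)] -/
theorem regionFreeReal_edgeCount_ge (hp : p ∈ Set.Icc (0 : ℝ) 1) (hq : 0 < q) (N : ℕ) (m : ℝ) :
    regionFreeReal d p q (box d N) {ω : BondConfig (Site d) | m ≤ ((ω ∩ ↑(edgesIn (zdGraph d) (box d N))).ncard : ℝ)} =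
      (rcMeasure (finsetGraph (zdGraph d) (box d N)) p q (boxBC d false N)).real
        {η : BondConfig ↥(box d N) | m ≤ (η.ncard : ℝ)} := by
  classical
  rw [regionFreeReal, rcMeasure_real_ncard_ge_eq _ hp hq, show boxBC d false N = (∅ : Set ↥(box d N)) from rfl,
    rcMeasure_real_eq_rcExpect _ hp hq]
  refine rcExpect_congr _ p q _ fun ω hω => ?_
  simp only [Set.mem_preimage, Set.mem_setOf_eq, ncard_liftEdges_inter_edgesIn (box d N) hω]

/-- `φ¹_{Λ_N,p,q}`-law of `{|ω ∩ E_N| ≤ m}` = the wired box-measure tail. [cite: Grimmett2006, §4.2 (4.11)–(4.12)] -/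
theorem regionWiredReal_edgeCount_le (hp : p ∈ Set.Icc (0 : ℝ) 1) (hq : 0 < q) (N : ℕ) (m : ℝ) :
    regionWiredReal d p q (box d N) {ω : BondConfig (Site d) | ((ω ∩ ↑(edgesIn (zdGraph d) (box d N))).ncard : ℝ) ≤ m} =
      (rcMeasure (finsetGraph (zdGraph d) (box d N)) p q (boxBC d true N)).real
        {η : BondConfig ↥(box d N) | (η.ncard : ℝ) ≤ m} := by
  classical
  rw [regionWiredReal, rcMeasure_real_ncard_le_eq _ hp hq, show boxBC d true N = wiredBoundary (zdGraph d) (box d N) from rfl,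
    rcMeasure_real_eq_rcExpect _ hp hq]
  refine rcExpect_congr _ p q _ fun ω hω => ?_
  simp only [Set.mem_preimage, Set.mem_setOf_eq, ncard_liftEdges_inter_edgesIn (box d N) hω]

variable {P : Measure (BondConfig (Site d))}

/-- **Sandwich, decreasing events, lower side**: `φ¹_{Λ,p,q}(D) ≤ P(D)` for a decreasing measurable event `D` determined by `E_Λ`
and every `FKGibbs d p q P` (complement of `FKGibbs.le_regionWiredReal`). [cite: Grimmett2006, Lemma (4.14)(b), Thm. (4.19)(c) (4.21)] -/
theorem fkGibbs_regionWiredReal_le_of_isLowerSet (hP : FKGibbs d p q P) (hp : p ∈ Set.Icc (0 : ℝ) 1) (hq : 0 < q)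
    (Λ : Finset (Site d)) {D : Set (BondConfig (Site d))} (hD : IsLowerSet D)
    (hDΛ : DeterminedBy D ↑(edgesIn (zdGraph d) Λ)) (hDm : MeasurableSet D) : regionWiredReal d p q Λ D ≤ P.real D := by
  haveI := hP.isProbabilityMeasure
  haveI := isProbabilityMeasure_rcMeasure (finsetGraph (zdGraph d) Λ) hp hq (wiredBoundary (zdGraph d) Λ)
  have hDc : IsUpperSet Dᶜ := hD.compl
  have hDcΛ : DeterminedBy Dᶜ ↑(edgesIn (zdGraph d) Λ) := by
    rw [determinedBy_iff] at hDΛ ⊢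
    exact fun ω ω' h => not_congr (hDΛ ω ω' h)
  have h := hP.le_regionWiredReal Λ hDc hDcΛ
  rw [measureReal_compl hDm, probReal_univ] at h
  have h2 : regionWiredReal d p q Λ Dᶜ = 1 - regionWiredReal d p q Λ D := by
    rw [regionWiredReal, regionWiredReal, Set.preimage_compl, measureReal_compl ((measurable_liftEdges Λ) hDm), probReal_univ]
  linarith

/-- **BOTH ENDPOINT DENSITIES UNDER EVERY INFINITE-VOLUME RANDOM-CLUSTER MEASURE, WIRED SIDE**: for every `FKGibbs d p q P`,
`δ, ε > 0`: eventually `e^{−ε|Λ_N|} ≤ P{||ω ∩ E_N| − d·h¹(p,q)|Λ_N|| < δ|Λ_N|}` (e.g. `φ⁰_{p,q}` at a first-order point reaches the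
wired density at sub-volume cost). [cite: Grimmett2006, Thm. (4.19)(c), (4.71); Ellis2006, Thm. V.6.1 (d)–(e)] -/
theorem fkGibbs_exp_le_edge_window_high (hP : FKGibbs d p q P) (hp : p ∈ Set.Ioo (0 : ℝ) 1) (hq : 1 ≤ q)
    (he₀ : e₀ ∈ (zdGraph d).edgeSet) {δ : ℝ} (hδ : 0 < δ) {ε : ℝ} (hε : 0 < ε) :
    ∀ᶠ N : ℕ in atTop, Real.exp (-(ε * #(box d N))) ≤
      P.real {ω : BondConfig (Site d) |
        |((ω ∩ ↑(edgesIn (zdGraph d) (box d N))).ncard : ℝ) - d * wiredEdgeDensity d p q e₀ * #(box d N)| < δ * #(box d N)} := by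
  have hpI : p ∈ Set.Icc (0 : ℝ) 1 := ⟨hp.1.le, hp.2.le⟩
  have hq0 : 0 < q := one_pos.trans_le hq
  haveI := hP.isProbabilityMeasure
  obtain ⟨i₀, -, -⟩ := exists_eq_map_add_of_mem_edgeSet he₀
  have hd : 0 < d := i₀.pos
  obtain ⟨κ, hκ, hA⟩ := exists_pos_eventually_le_wired_high hpI hq he₀ (half_pos hδ)
  obtain ⟨c, hc, hU⟩ := fkGibbs_upper_tail_exp_decay hp hq he₀ (m := d * wiredEdgeDensity d p q e₀ + δ) (by linarith)
  have h := eventually_forall_exp_le_of_boundary_sub_exp (d := d) (ι := Unit) hq hκ hc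
    (f := fun N _ => P.real {ω : BondConfig (Site d) |
      |((ω ∩ ↑(edgesIn (zdGraph d) (box d N))).ncard : ℝ) - d * wiredEdgeDensity d p q e₀ * #(box d N)| < δ * #(box d N)}) ?_ hd hε
  · exact h.mono fun N hN => hN ()
  filter_upwards [hA, hU hP] with N hAN hUN _
  have hsub := IsingLargeDeviations.diff_halfLines_subset_window
    (fun ω : BondConfig (Site d) => ((ω ∩ ↑(edgesIn (zdGraph d) (box d N))).ncard : ℝ)) (#(box d N) : ℝ) δ
    (d * wiredEdgeDensity d p q e₀)
  -- lower bound for the increasing event through the free region law and the boundary cost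
  have hA1 := hP.regionFreeReal_le (box d N) (isUpperSet_edgeCount_ge (edgesIn (zdGraph d) (box d N))
    ((d * wiredEdgeDensity d p q e₀ - δ / 2) * #(box d N))) (determinedBy_edgeCount_ge _ _)
  rw [regionFreeReal_edgeCount_ge hpI hq0] at hA1
  have hAb := pow_inv_mul_rcMeasure_box_real_le hpI hq N true false
    {η : BondConfig ↥(box d N) | (d * wiredEdgeDensity d p q e₀ - δ / 2) * #(box d N) ≤ (η.ncard : ℝ)}
  have hAκ := ((mul_le_mul_of_nonneg_left hAN (inv_nonneg.2 (pow_nonneg hq0.le _))).trans hAb).trans hA1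
  exact (sub_le_sub hAκ hUN).trans (IsingLargeDeviations.measureReal_sub_le_of_diff_subset _ hsub)

/-- **BOTH ENDPOINT DENSITIES UNDER EVERY INFINITE-VOLUME RANDOM-CLUSTER MEASURE, FREE SIDE**: for every `FKGibbs d p q P`,
eventually `e^{−ε|Λ_N|} ≤ P{||ω ∩ E_N| − d·h⁰(p,q)|Λ_N|| < δ|Λ_N|}` (e.g. `φ¹_{p,q}` reaches the free density at sub-volume cost).
[cite: Grimmett2006, Thm. (4.19)(c), (4.71); Ellis2006, Thm. V.6.1 (d)–(e)] -/
theorem fkGibbs_exp_le_edge_window_low (hP : FKGibbs d p q P) (hp : p ∈ Set.Ioo (0 : ℝ) 1) (hq : 1 ≤ q)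
    (he₀ : e₀ ∈ (zdGraph d).edgeSet) {δ : ℝ} (hδ : 0 < δ) {ε : ℝ} (hε : 0 < ε) :
    ∀ᶠ N : ℕ in atTop, Real.exp (-(ε * #(box d N))) ≤
      P.real {ω : BondConfig (Site d) |
        |((ω ∩ ↑(edgesIn (zdGraph d) (box d N))).ncard : ℝ) - d * freeEdgeDensity d p q e₀ * #(box d N)| < δ * #(box d N)} := by
  have hpI : p ∈ Set.Icc (0 : ℝ) 1 := ⟨hp.1.le, hp.2.le⟩
  have hq0 : 0 < q := one_pos.trans_le hq
  haveI := hP.isProbabilityMeasure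
  obtain ⟨i₀, -, -⟩ := exists_eq_map_add_of_mem_edgeSet he₀
  have hd : 0 < d := i₀.pos
  obtain ⟨κ, hκ, hA⟩ := exists_pos_eventually_le_free_low hpI hq he₀ (half_pos hδ)
  obtain ⟨c, hc, hL⟩ := fkGibbs_lower_tail_exp_decay hp hq he₀ (m := d * freeEdgeDensity d p q e₀ - δ) (by linarith)
  have h := eventually_forall_exp_le_of_boundary_sub_exp (d := d) (ι := Unit) hq hκ hc
    (f := fun N _ => P.real {ω : BondConfig (Site d) |
      |((ω ∩ ↑(edgesIn (zdGraph d) (box d N))).ncard : ℝ) - d * freeEdgeDensity d p q e₀ * #(box d N)| < δ * #(box d N)}) ?_ hd hε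
  · exact h.mono fun N hN => hN ()
  filter_upwards [hA, hL hP] with N hAN hLN _
  have hsub := IsingLargeDeviations.diff_halfLines_subset_window_neg
    (fun ω : BondConfig (Site d) => ((ω ∩ ↑(edgesIn (zdGraph d) (box d N))).ncard : ℝ)) (#(box d N) : ℝ) δ
    (d * freeEdgeDensity d p q e₀)
  have hA1 := fkGibbs_regionWiredReal_le_of_isLowerSet hP hpI hq0 (box d N)
    (isLowerSet_edgeCount_le (edgesIn (zdGraph d) (box d N)) ((d * freeEdgeDensity d p q e₀ + δ / 2) * #(box d N)))
    (determinedBy_edgeCount_le _ _) ((determinedBy_edgeCount_le _ _).measurableSet_of_finset)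
  rw [regionWiredReal_edgeCount_le hpI hq0] at hA1
  have hAb := pow_inv_mul_rcMeasure_box_real_le hpI hq N false true
    {η : BondConfig ↥(box d N) | (η.ncard : ℝ) ≤ (d * freeEdgeDensity d p q e₀ + δ / 2) * #(box d N)}
  have hAκ := ((mul_le_mul_of_nonneg_left hAN (inv_nonneg.2 (pow_nonneg hq0.le _))).trans hAb).trans hA1
  exact (sub_le_sub hAκ hLN).trans (IsingLargeDeviations.measureReal_sub_le_of_diff_subset _ hsub)

end RandomClusterLargeDeviations

end Summit.CriticalPhenomena.PercolationContinuityZ3.Theorems.FK
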